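import Mathlib
import Summits.Ventures.HodgeRepro.Tier4.Common.PlaneGenuine
import Summits.Ventures.HodgeRepro.Tier4.Common.MixedPlaneKType

/-!
# Tier4/Common/PlaneTransport — transporting the second torus preserves genuineness and hermitianity
(t4-crit-2's (j6), S12307: «`Q` transported from genuine projectors by a genuine isometry is rank 2»)

Blind re-derivation cell `pub-hodge-repro`, Tier 4 (README §9–§10), seat t4-typer-2 (gen 0).  Target tree path
`lean/Summits/Ventures/HodgeRepro/Tier4/Common/PlaneTransport.lean`.  Imports `Tier4/Common/PlaneGenuine.lean`
(`IsGenuinePlane`, `IsHermitianPlane`) and `Tier4/Common/MixedPlaneKType.lean` (`PlaneData.withTransportedTorus`).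

`withTransportedTorus W g g′` replaces the second projectors by `g P g′` (`g g′ = g′ g = 1`); the trace of
`g P g′` is the trace of `P g′ g = P` (`Matrix.trace_mul_comm`), and `B`, `Ω`, `P` are untouched — so every clause
of `IsGenuinePlane` / `IsHermitianPlane` is inherited: **`withTransportedTorus_isGenuine`**,
**`withTransportedTorus_isHermitian`**.  In particular L4's plane
`(PlaneData.mixed q a₀ a₂).withTransportedTorus g g′ …` is hermitian by `mixed_isHermitian` — no hypothesis.

Nothing here says anything about the status of the Hodge conjecture for CM abelian varieties, which is NOT proved
(HC_CM is NOT proved by anyone in this repository).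
-/

set_option autoImplicit false

noncomputable section

namespace Summit.Ventures.HodgeRepro.Tier4.Common

open Matrix

variable {k : Type} [Field k]

/-- The trace of a conjugated projector is the trace of the projector. -/
theorem trace_conj_eq (P g g' : Matrix (Fin 4) (Fin 4) k) (hg'g : g' * g = 1) :
    Matrix.trace (g * P * g') = Matrix.trace P := by
  rw [Matrix.trace_mul_comm, ← Matrix.mul_assoc, hg'g, Matrix.one_mul]

/-- **Transporting the second torus preserves genuineness.** -/
theorem withTransportedTorus_isGenuine (q : QuadData k) (W : PlaneData k) (hW : IsGenuinePlane q W)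
    (g g' : Matrix (Fin 4) (Fin 4) k) (hgg' : g * g' = 1) (hg'g : g' * g = 1) (hgΩ : g * W.Ω = W.Ω * g) :
    IsGenuinePlane q (W.withTransportedTorus g g' hgg' hg'g hgΩ) := by
  obtain ⟨hP, -, hΩ, hΩs, hB⟩ := hW
  refine ⟨hP, fun i => ?_, hΩ, hΩs, hB⟩
  show Matrix.trace (g * W.P i * g') = 2
  rw [trace_conj_eq _ _ _ hg'g, hP i]

/-- **Transporting the second torus preserves hermitianity.** -/
theorem withTransportedTorus_isHermitian (q : QuadData k) (W : PlaneData k) (hW : IsHermitianPlane q W)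
    (g g' : Matrix (Fin 4) (Fin 4) k) (hgg' : g * g' = 1) (hg'g : g' * g = 1) (hgΩ : g * W.Ω = W.Ω * g) :
    IsHermitianPlane q (W.withTransportedTorus g g' hgg' hg'g hgΩ) :=
  ⟨withTransportedTorus_isGenuine q W hW.1 g g' hgg' hg'g hgΩ, hW.2⟩

/-- **L4's plane is hermitian with no hypothesis**: the mixed plane with a transported torus. -/
theorem mixed_withTransportedTorus_isHermitian (q : QuadData k) (a b : k) (ha : a ≠ 0) (hb : b ≠ 0)
    (hq : q.t ^ 2 - 4 * q.n ≠ 0) (g g' : Matrix (Fin 4) (Fin 4) k) (hgg' : g * g' = 1) (hg'g : g' * g = 1)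
    (hgΩ : g * (PlaneData.mixed q a b).Ω = (PlaneData.mixed q a b).Ω * g) :
    IsHermitianPlane q ((PlaneData.mixed q a b).withTransportedTorus g g' hgg' hg'g hgΩ) :=
  withTransportedTorus_isHermitian q _ (mixed_isHermitian q a b ha hb hq) g g' hgg' hg'g hgΩ

end Summit.Ventures.HodgeRepro.Tier4.Common

end
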